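import Summits.QuantumFields.GaugeBoot.ZdLoopEquationStates
import Summits.QuantumFields.GaugeBoot.PeriodicWordReflection
import HarnessLib

/-!
# Symmetry identifications of the loop variables of a Class-B / Class-T state on `ℤ^d` (gauge-boot, `ℤ^d` loop equations, supplement)

HONEST FRAMING (cell `pub-gaugeboot`, page 1 of every file): the venture produces certified bounds
on lattice expectations at stated coupling, gauge group, dimension and torus size; NOT a mass gap,
NOT a continuum limit, NOT a string tension; NOT Yang–Mills-summit-bearing (barriers
`FixedCouplingUltralocality`, `PerturbativeInvisibility`).

Besides Gram positivity, reflection positivities and the loop equations (`ZdLoopEquationStates.lean`),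
a loop-equation SDP uses SYMMETRY IDENTIFICATIONS of its variables: loop (and loop-pair) expectations
are unchanged under lattice translations and under the hyperoctahedral group (axis permutations and
axis reflections) acting on the words. For the torus these are `WordSymmetry.lean`; for periodic
lattices `PeriodicWordSymmetry.lean` / `PeriodicWordReflection.lean`. This file is the `ℤ^d` version
for the invariance AXIOMS of `ClassBState` (`translationInvariant`, `permInvariant`,
`reflectInvariant`) and of `TiltedRP.TiltedClassState` (`translationInvariant`, `swapInvariant`,
`reflectInvariant`), in the `wordHolonomyZd` vocabulary of `ClassBWords.lean`:

* how the three families of configuration maps of `ClassB.lean` / `LatticeGaugeDLR` read words: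
  `wordHolonomyZd_configShift` (`hol_x(w)(θ_v U) = hol_{x−v}(w)(U)`), `wordHolonomyZd_configPerm`
  (`hol_x(w)(U ∘ σ) = hol_{x∘σ}(σ⁻¹·w)(U)`, letters permuted by `Step.permute σ⁻¹`),
  `wordHolonomyZd_configSiteReflect` (`hol_x(w)(Θ_i U) = hol_{θ_i x}(flip_i w)(U)`, letters `±e_i`
  exchanged by `Step.flipAt i`);
* for any measure invariant under the map, the integral of any continuous function of the
  configuration is unchanged (`integral_comp_configShift_eq`, `integral_comp_eq_of_measurePreserving`),
  hence the loop variables `∫ tr ρ(hol_x w) dμ` and pair variables `∫ tr ρ(hol_x u)·tr ρ(hol_y w) dμ`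
  are invariant under `x ↦ x + v`, under `(x, w) ↦ (x ∘ σ, σ⁻¹·w)` and under
  `(x, w) ↦ (θ_i x, flip_i w)`;
* the corollaries for `ClassBState` (all translations, all `σ ∈ S_d`, all axis flips) and for
  `TiltedClassState d i j` (all translations, the transposition `(i j)`, all axis flips).

Everything is `[folklore]` (change of variables under a measure-preserving bijection).

References: V. Kazakov, Z. Zheng, arXiv:2203.11360 §3.3 (symmetry reduction of loop variables);
H.-O. Georgii, *Gibbs Measures and Phase Transitions* (2011) §5.1.
-/

noncomputable section

open MeasureTheory
open scoped Matrix
open Literature.Probability.LatticeModels (Site)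
open Literature.MathematicalPhysics.QuantumLattice (LGConfig ZdEdge configShift configShift_apply
  IsZdTranslationInvariant)

namespace Summit.QuantumFields.GaugeBoot

variable {d N : ℕ} {G : Type*} [Group G]

/-! ### How the configuration maps read words -/

section Algebra

/-- **Translations**: `hol_x(w)(θ_v U) = hol_{x−v}(w)(U)` (`configShift v U (y, k) = U (y − v, k)`).
[folklore] -/
theorem wordHolonomyZd_configShift [MeasurableSpace G] (v : Site d) (U : LGConfig d G) :
    ∀ (x : Site d) (w : Word d), wordHolonomyZd (configShift v U) x w = wordHolonomyZd U (x - v) w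
  | x, [] => rfl
  | x, s :: w => by
    rw [wordHolonomyZd_cons, wordHolonomyZd_cons, wordHolonomyZd_configShift v U (s.applyZd x) w]
    cases s with
    | fwd μ =>
      simp only [stepHolonomyZd_fwd, configShift_apply, Step.applyZd_fwd]
      rw [add_sub_right_comm]
    | bwd μ =>
      simp only [stepHolonomyZd_bwd, configShift_apply, Step.applyZd_bwd]
      rw [sub_right_comm]

/-- A unit vector read through an axis permutation: `e_μ ∘ σ = e_{σ⁻¹ μ}`. [folklore] -/
theorem single_comp_perm (σ : Equiv.Perm (Fin d)) (μ : Fin d) :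
    ((Pi.single μ (1 : ℤ) : Site d) ∘ σ) = Pi.single (σ.symm μ) 1 := by
  ext k
  simp only [Function.comp_apply, Pi.single_apply, Equiv.apply_eq_iff_eq_symm_apply]

/-- Steps read through an axis permutation. [folklore] -/
theorem applyZd_comp_perm (σ : Equiv.Perm (Fin d)) (x : Site d) (s : Step d) :
    (s.applyZd x) ∘ σ = (s.permute σ.symm).applyZd (x ∘ σ) := by
  cases s with
  | fwd μ => ext k; simp [Step.applyZd, ← single_comp_perm σ μ]
  | bwd μ => ext k; simp [Step.applyZd, ← single_comp_perm σ μ]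

/-- Step holonomies of the permuted configuration. [folklore] -/
theorem stepHolonomyZd_configPerm (σ : Equiv.Perm (Fin d)) (U : LGConfig d G) (x : Site d) (s : Step d) :
    stepHolonomyZd (configPerm σ U) x s = stepHolonomyZd U (x ∘ σ) (s.permute σ.symm) := by
  cases s with
  | fwd μ => rfl
  | bwd μ =>
    simp only [stepHolonomyZd_bwd, Step.permute_bwd, configPerm]
    rw [show (x - Pi.single μ 1) ∘ σ = x ∘ σ - Pi.single (σ.symm μ) 1 by
      ext k; simp [← single_comp_perm σ μ]]

/-- **Axis permutations**: `hol_x(w)(U^σ) = hol_{x∘σ}(σ⁻¹·w)(U)` (`configPerm σ U (y, k) = U (y∘σ, σ⁻¹k)`;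
letters permuted by `Step.permute σ⁻¹`). [folklore] -/
theorem wordHolonomyZd_configPerm (σ : Equiv.Perm (Fin d)) (U : LGConfig d G) :
    ∀ (x : Site d) (w : Word d),
      wordHolonomyZd (configPerm σ U) x w = wordHolonomyZd U (x ∘ σ) (w.map (Step.permute σ.symm))
  | x, [] => rfl
  | x, s :: w => by
    rw [List.map_cons, wordHolonomyZd_cons, wordHolonomyZd_cons, stepHolonomyZd_configPerm,
      wordHolonomyZd_configPerm σ U (s.applyZd x) w, applyZd_comp_perm]

/-- The site reflection `θ_i` negates the `i`-th unit vector and fixes the others, on steps: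
`θ_i(x ± e_k) = θ_i x ± e_k` (`k ≠ i`), `θ_i(x ± e_i) = θ_i x ∓ e_i`. [folklore] -/
theorem zdSiteReflect_applyZd (i : Fin d) (x : Site d) (s : Step d) :
    zdSiteReflect i (s.applyZd x) = (s.flipAt i).applyZd (zdSiteReflect i x) := by
  cases s with
  | fwd μ =>
    by_cases h : μ = i
    · subst h
      ext k; by_cases hk : k = μ
      · subst hk; simp [zdSiteReflect, Step.applyZd]; ring
      · simp [zdSiteReflect, Step.applyZd, hk]
    · ext k; by_cases hk : k = i
      · subst hk; simp [zdSiteReflect, Step.applyZd, Step.flipAt_fwd_of_ne h, Ne.symm h]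
      · simp [zdSiteReflect, Step.applyZd, Step.flipAt_fwd_of_ne h, hk]
  | bwd μ =>
    by_cases h : μ = i
    · subst h
      ext k; by_cases hk : k = μ
      · subst hk; simp [zdSiteReflect, Step.applyZd]; ring
      · simp [zdSiteReflect, Step.applyZd, hk]
    · ext k; by_cases hk : k = i
      · subst hk; simp [zdSiteReflect, Step.applyZd, Step.flipAt_bwd_of_ne h, Ne.symm h]
      · simp [zdSiteReflect, Step.applyZd, Step.flipAt_bwd_of_ne h, hk]

/-- Step holonomies of the reflected configuration. [folklore] -/
theorem stepHolonomyZd_configSiteReflect (i : Fin d) (U : LGConfig d G) (x : Site d) (s : Step d) :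
    stepHolonomyZd (configSiteReflect i U) x s = stepHolonomyZd U (zdSiteReflect i x) (s.flipAt i) := by
  cases s with
  | fwd μ =>
    by_cases h : μ = i
    · subst h
      simp only [stepHolonomyZd_fwd, configSiteReflect, if_true, Step.flipAt_fwd_self, stepHolonomyZd_bwd]
    · simp only [stepHolonomyZd_fwd, configSiteReflect, h, if_false, Step.flipAt_fwd_of_ne h]
  | bwd μ =>
    by_cases h : μ = i
    · subst h
      simp only [stepHolonomyZd_bwd, configSiteReflect, if_true, Step.flipAt_bwd_self, stepHolonomyZd_fwd,
        inv_inv, zdSiteReflect_sub_single, add_sub_cancel_right]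
    · have hθ : zdSiteReflect i (x - Pi.single μ 1) = zdSiteReflect i x - Pi.single μ 1 := by
        simpa [Step.flipAt_bwd_of_ne h] using zdSiteReflect_applyZd i x (.bwd μ)
      simp only [stepHolonomyZd_bwd, configSiteReflect, h, if_false, Step.flipAt_bwd_of_ne h, hθ]

/-- **Axis reflections**: `hol_x(w)(Θ_i U) = hol_{θ_i x}(flip_i w)(U)` (`configSiteReflect i`; letters
`±e_i` exchanged by `Step.flipAt i`). [folklore] -/
theorem wordHolonomyZd_configSiteReflect (i : Fin d) (U : LGConfig d G) :
    ∀ (x : Site d) (w : Word d),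
      wordHolonomyZd (configSiteReflect i U) x w =
        wordHolonomyZd U (zdSiteReflect i x) (w.map (Step.flipAt i))
  | x, [] => rfl
  | x, s :: w => by
    rw [List.map_cons, wordHolonomyZd_cons, wordHolonomyZd_cons, stepHolonomyZd_configSiteReflect,
      wordHolonomyZd_configSiteReflect i U (s.applyZd x) w, zdSiteReflect_applyZd]

end Algebra

/-! ### Change of variables under the invariances -/

section Continuity

variable [TopologicalSpace G] [IsTopologicalGroup G] (ρ : G →* Matrix (Fin N) (Fin N) ℂ)

/-- Continuity of `U ↦ tr ρ(hol_x w)` on `ℤ^d`. [folklore] -/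
theorem continuous_trace_wordHolonomyZd (hρ : Continuous ρ) (x : Site d) (w : Word d) :
    Continuous fun U : LGConfig d G => (ρ (wordHolonomyZd U x w)).trace :=
  (hρ.comp (continuous_wordHolonomyZd x w)).matrix_trace

end Continuity

section Integrals

variable [MeasurableSpace G] {μW : Measure (LGConfig d G)}

omit [Group G] in
/-- For a translation-invariant measure, `∫ Φ(θ_v U) dμ = ∫ Φ dμ`. [folklore] -/
theorem integral_comp_configShift_eq (hT : IsZdTranslationInvariant μW) (v : Site d)
    (Φ : LGConfig d G → ℂ) : ∫ U, Φ (configShift v U) ∂μW = ∫ U, Φ U ∂μW := by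
  rw [← integral_map_equiv, hT v]

variable [TopologicalSpace G] [BorelSpace G] [SecondCountableTopology G]

omit [Group G] in
/-- For a measure preserved by `T`, `∫ Φ(T U) dμ = ∫ Φ dμ` (continuous `Φ`). [folklore] -/
theorem integral_comp_eq_of_measurePreserving {T : LGConfig d G → LGConfig d G}
    (hT : MeasurePreserving T μW μW) (Φ : LGConfig d G → ℂ) (hΦ : Continuous Φ) :
    ∫ U, Φ (T U) ∂μW = ∫ U, Φ U ∂μW := by
  rw [← integral_map hT.measurable.aemeasurable (by rw [hT.map_eq]; exact hΦ.aestronglyMeasurable),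
    hT.map_eq]

variable [IsTopologicalGroup G] (ρ : G →* Matrix (Fin N) (Fin N) ℂ)

omit [TopologicalSpace G] [BorelSpace G] [SecondCountableTopology G] [IsTopologicalGroup G] in
/-- **Loop and pair variables are translation invariant**: for a translation-invariant measure,
`∫ tr ρ(hol_{x+v} u)·tr ρ(hol_{y+v} w) dμ = ∫ tr ρ(hol_x u)·tr ρ(hol_y w) dμ`. [folklore] -/
theorem integral_trace_mul_trace_wordHolonomyZd_add (hT : IsZdTranslationInvariant μW) (v x y : Site d)
    (u w : Word d) :
    ∫ U, (ρ (wordHolonomyZd U (x + v) u)).trace * (ρ (wordHolonomyZd U (y + v) w)).trace ∂μW =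
      ∫ U, (ρ (wordHolonomyZd U x u)).trace * (ρ (wordHolonomyZd U y w)).trace ∂μW := by
  have h := integral_comp_configShift_eq hT v
    fun U => (ρ (wordHolonomyZd U (x + v) u)).trace * (ρ (wordHolonomyZd U (y + v) w)).trace
  simp only [wordHolonomyZd_configShift, add_sub_cancel_right] at h
  exact h.symm

omit [TopologicalSpace G] [BorelSpace G] [SecondCountableTopology G] [IsTopologicalGroup G] in
/-- Loop variables are translation invariant: `∫ tr ρ(hol_{x+v} w) dμ = ∫ tr ρ(hol_x w) dμ`. [folklore] -/
theorem integral_trace_wordHolonomyZd_add (hT : IsZdTranslationInvariant μW) (v x : Site d) (w : Word d) :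
    ∫ U, (ρ (wordHolonomyZd U (x + v) w)).trace ∂μW = ∫ U, (ρ (wordHolonomyZd U x w)).trace ∂μW := by
  have h := integral_comp_configShift_eq hT v fun U => (ρ (wordHolonomyZd U (x + v) w)).trace
  simp only [wordHolonomyZd_configShift, add_sub_cancel_right] at h
  exact h.symm

/-- **Loop and pair variables are invariant under an axis permutation preserving the measure**:
`∫ tr ρ(hol_{x∘σ}(σ⁻¹·u))·tr ρ(hol_{y∘σ}(σ⁻¹·w)) dμ = ∫ tr ρ(hol_x u)·tr ρ(hol_y w) dμ`. [folklore] -/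
theorem integral_trace_mul_trace_wordHolonomyZd_perm (hρ : Continuous ρ) {σ : Equiv.Perm (Fin d)}
    (hσ : MeasurePreserving (configPerm σ) μW μW) (x y : Site d) (u w : Word d) :
    ∫ U, (ρ (wordHolonomyZd U (x ∘ σ) (u.map (Step.permute σ.symm)))).trace *
        (ρ (wordHolonomyZd U (y ∘ σ) (w.map (Step.permute σ.symm)))).trace ∂μW =
      ∫ U, (ρ (wordHolonomyZd U x u)).trace * (ρ (wordHolonomyZd U y w)).trace ∂μW := by
  have h := integral_comp_eq_of_measurePreserving hσ
    (fun U => (ρ (wordHolonomyZd U x u)).trace * (ρ (wordHolonomyZd U y w)).trace)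
    ((continuous_trace_wordHolonomyZd ρ hρ x u).mul (continuous_trace_wordHolonomyZd ρ hρ y w))
  simp only [wordHolonomyZd_configPerm] at h
  exact h

/-- Loop variables are invariant under an axis permutation preserving the measure. [folklore] -/
theorem integral_trace_wordHolonomyZd_perm (hρ : Continuous ρ) {σ : Equiv.Perm (Fin d)}
    (hσ : MeasurePreserving (configPerm σ) μW μW) (x : Site d) (w : Word d) :
    ∫ U, (ρ (wordHolonomyZd U (x ∘ σ) (w.map (Step.permute σ.symm)))).trace ∂μW =
      ∫ U, (ρ (wordHolonomyZd U x w)).trace ∂μW := by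
  have h := integral_comp_eq_of_measurePreserving hσ (fun U => (ρ (wordHolonomyZd U x w)).trace)
    (continuous_trace_wordHolonomyZd ρ hρ x w)
  simp only [wordHolonomyZd_configPerm] at h
  exact h

/-- **Loop and pair variables are invariant under an axis reflection preserving the measure**:
`∫ tr ρ(hol_{θ_i x}(flip_i u))·tr ρ(hol_{θ_i y}(flip_i w)) dμ = ∫ tr ρ(hol_x u)·tr ρ(hol_y w) dμ`.
[folklore] -/
theorem integral_trace_mul_trace_wordHolonomyZd_flipAt (hρ : Continuous ρ) {i : Fin d}
    (hi : MeasurePreserving (configSiteReflect i) μW μW) (x y : Site d) (u w : Word d) :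
    ∫ U, (ρ (wordHolonomyZd U (zdSiteReflect i x) (u.map (Step.flipAt i)))).trace *
        (ρ (wordHolonomyZd U (zdSiteReflect i y) (w.map (Step.flipAt i)))).trace ∂μW =
      ∫ U, (ρ (wordHolonomyZd U x u)).trace * (ρ (wordHolonomyZd U y w)).trace ∂μW := by
  have h := integral_comp_eq_of_measurePreserving hi
    (fun U => (ρ (wordHolonomyZd U x u)).trace * (ρ (wordHolonomyZd U y w)).trace)
    ((continuous_trace_wordHolonomyZd ρ hρ x u).mul (continuous_trace_wordHolonomyZd ρ hρ y w))
  simp only [wordHolonomyZd_configSiteReflect] at h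
  exact h

/-- Loop variables are invariant under an axis reflection preserving the measure. [folklore] -/
theorem integral_trace_wordHolonomyZd_flipAt (hρ : Continuous ρ) {i : Fin d}
    (hi : MeasurePreserving (configSiteReflect i) μW μW) (x : Site d) (w : Word d) :
    ∫ U, (ρ (wordHolonomyZd U (zdSiteReflect i x) (w.map (Step.flipAt i)))).trace ∂μW =
      ∫ U, (ρ (wordHolonomyZd U x w)).trace ∂μW := by
  have h := integral_comp_eq_of_measurePreserving hi (fun U => (ρ (wordHolonomyZd U x w)).trace)
    (continuous_trace_wordHolonomyZd ρ hρ x w)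
  simp only [wordHolonomyZd_configSiteReflect] at h
  exact h

end Integrals

/-! ### Class-B and Class-T states -/

section States

variable [TopologicalSpace G] [IsTopologicalGroup G] [MeasurableSpace G] [BorelSpace G]
  [SecondCountableTopology G] {ρ : G →* Matrix (Fin N) (Fin N) ℂ} {β : ℝ}

/-- **Class B: pair variables are invariant under translations, all axis permutations and all axis
reflections** — the symmetry identifications of a Class-B SDP are theorems about every
`ω : ClassBState`. [folklore] -/
theorem ClassBState.integral_trace_mul_trace_symm (hρ : Continuous ρ) (ω : ClassBState d ρ β)
    (x y : Site d) (u w : Word d) :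
    (∀ v : Site d,
        ∫ U, (ρ (wordHolonomyZd U (x + v) u)).trace * (ρ (wordHolonomyZd U (y + v) w)).trace ∂ω.μ =
          ∫ U, (ρ (wordHolonomyZd U x u)).trace * (ρ (wordHolonomyZd U y w)).trace ∂ω.μ) ∧
      (∀ σ : Equiv.Perm (Fin d),
        ∫ U, (ρ (wordHolonomyZd U (x ∘ σ) (u.map (Step.permute σ.symm)))).trace *
            (ρ (wordHolonomyZd U (y ∘ σ) (w.map (Step.permute σ.symm)))).trace ∂ω.μ =
          ∫ U, (ρ (wordHolonomyZd U x u)).trace * (ρ (wordHolonomyZd U y w)).trace ∂ω.μ) ∧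
      (∀ i : Fin d,
        ∫ U, (ρ (wordHolonomyZd U (zdSiteReflect i x) (u.map (Step.flipAt i)))).trace *
            (ρ (wordHolonomyZd U (zdSiteReflect i y) (w.map (Step.flipAt i)))).trace ∂ω.μ =
          ∫ U, (ρ (wordHolonomyZd U x u)).trace * (ρ (wordHolonomyZd U y w)).trace ∂ω.μ) :=
  ⟨fun v => integral_trace_mul_trace_wordHolonomyZd_add ρ ω.translationInvariant v x y u w,
    fun σ => integral_trace_mul_trace_wordHolonomyZd_perm ρ hρ (ω.permInvariant σ) x y u w,
    fun i => integral_trace_mul_trace_wordHolonomyZd_flipAt ρ hρ (ω.reflectInvariant i) x y u w⟩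

/-- Class B: loop variables are invariant under translations, axis permutations and axis reflections.
[folklore] -/
theorem ClassBState.integral_trace_symm (hρ : Continuous ρ) (ω : ClassBState d ρ β) (x : Site d)
    (w : Word d) :
    (∀ v : Site d, ∫ U, (ρ (wordHolonomyZd U (x + v) w)).trace ∂ω.μ =
        ∫ U, (ρ (wordHolonomyZd U x w)).trace ∂ω.μ) ∧
      (∀ σ : Equiv.Perm (Fin d),
        ∫ U, (ρ (wordHolonomyZd U (x ∘ σ) (w.map (Step.permute σ.symm)))).trace ∂ω.μ =
          ∫ U, (ρ (wordHolonomyZd U x w)).trace ∂ω.μ) ∧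
      (∀ i : Fin d, ∫ U, (ρ (wordHolonomyZd U (zdSiteReflect i x) (w.map (Step.flipAt i)))).trace ∂ω.μ =
          ∫ U, (ρ (wordHolonomyZd U x w)).trace ∂ω.μ) :=
  ⟨fun v => integral_trace_wordHolonomyZd_add ρ ω.translationInvariant v x w,
    fun σ => integral_trace_wordHolonomyZd_perm ρ hρ (ω.permInvariant σ) x w,
    fun i => integral_trace_wordHolonomyZd_flipAt ρ hρ (ω.reflectInvariant i) x w⟩

/-- **Class T (tilted plane `(i, j)`): pair variables are invariant under translations, the axis
transposition `(i j)` and all axis reflections.** [folklore] -/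
theorem TiltedRP.TiltedClassState.integral_trace_mul_trace_symm (hρ : Continuous ρ) {i j : Fin d}
    (ω : TiltedRP.TiltedClassState d i j ρ β) (x y : Site d) (u w : Word d) :
    (∀ v : Site d,
        ∫ U, (ρ (wordHolonomyZd U (x + v) u)).trace * (ρ (wordHolonomyZd U (y + v) w)).trace ∂ω.μ =
          ∫ U, (ρ (wordHolonomyZd U x u)).trace * (ρ (wordHolonomyZd U y w)).trace ∂ω.μ) ∧
      (∫ U, (ρ (wordHolonomyZd U (x ∘ Equiv.swap i j) (u.map (Step.permute (Equiv.swap i j))))).trace *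
            (ρ (wordHolonomyZd U (y ∘ Equiv.swap i j) (w.map (Step.permute (Equiv.swap i j))))).trace
          ∂ω.μ =
        ∫ U, (ρ (wordHolonomyZd U x u)).trace * (ρ (wordHolonomyZd U y w)).trace ∂ω.μ) ∧
      (∀ k : Fin d,
        ∫ U, (ρ (wordHolonomyZd U (zdSiteReflect k x) (u.map (Step.flipAt k)))).trace *
            (ρ (wordHolonomyZd U (zdSiteReflect k y) (w.map (Step.flipAt k)))).trace ∂ω.μ =
          ∫ U, (ρ (wordHolonomyZd U x u)).trace * (ρ (wordHolonomyZd U y w)).trace ∂ω.μ) := by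
  refine ⟨fun v => integral_trace_mul_trace_wordHolonomyZd_add ρ ω.translationInvariant v x y u w, ?_,
    fun k => integral_trace_mul_trace_wordHolonomyZd_flipAt ρ hρ (ω.reflectInvariant k) x y u w⟩
  have h := integral_trace_mul_trace_wordHolonomyZd_perm ρ hρ ω.swapInvariant x y u w
  rwa [Equiv.symm_swap] at h

/-- Class T: loop variables are invariant under translations, the transposition `(i j)` and all axis
reflections. [folklore] -/
theorem TiltedRP.TiltedClassState.integral_trace_symm (hρ : Continuous ρ) {i j : Fin d}
    (ω : TiltedRP.TiltedClassState d i j ρ β) (x : Site d) (w : Word d) :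
    (∀ v : Site d, ∫ U, (ρ (wordHolonomyZd U (x + v) w)).trace ∂ω.μ =
        ∫ U, (ρ (wordHolonomyZd U x w)).trace ∂ω.μ) ∧
      (∫ U, (ρ (wordHolonomyZd U (x ∘ Equiv.swap i j) (w.map (Step.permute (Equiv.swap i j))))).trace ∂ω.μ =
          ∫ U, (ρ (wordHolonomyZd U x w)).trace ∂ω.μ) ∧
      (∀ k : Fin d, ∫ U, (ρ (wordHolonomyZd U (zdSiteReflect k x) (w.map (Step.flipAt k)))).trace ∂ω.μ =
          ∫ U, (ρ (wordHolonomyZd U x w)).trace ∂ω.μ) := by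
  refine ⟨fun v => integral_trace_wordHolonomyZd_add ρ ω.translationInvariant v x w, ?_,
    fun k => integral_trace_wordHolonomyZd_flipAt ρ hρ (ω.reflectInvariant k) x w⟩
  have h := integral_trace_wordHolonomyZd_perm ρ hρ ω.swapInvariant x w
  rwa [Equiv.symm_swap] at h

end States

end Summit.QuantumFields.GaugeBoot

end
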